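import Summits.Ventures.PercRepro.RankLevelSetDepCountGiantB2

/-!
# PercRepro — S2: THE SQUARE MULTIPLICITY — a rank-`q` `m`-set lies in the fibre of at least `(m − q)²` pairs
(p7, gen 2; sub-claim S2, the `U`-side of the level-`5` cells)

Night-1's multiplicity (`card_pairs_ge`, RankLevelSetDepCountGiantA): a rank-`q` set `B` with `m = q + ν` elements lies
in the level-`m` fibre of at least `ν` pairs `(C, B′)` — the sets `I ∪ {x}`, `x ∈ B ∖ I`, for a basis `I` of `B`.
THE SQUARE: for every two elements `x ≠ y` of `X := B ∖ I` and every `z ∈ I` on the fundamental circuit of `x` (at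
least two such `z`, every circuit having `≥ 3` elements), the set `(I ∖ {z}) ∪ {x, y}` is a further SPANNING
`(q+1)`-subset of `B` (its closure contains `cl((I ∪ {x}) ∖ {z}) = cl(I ∪ {x}) ⊇ B`), and all these sets are distinct:
`B` has at least `ν + 2·C(ν, 2) = ν²` spanning `(q+1)`-subsets (`card_spanF_ge_sq`), each the union of exactly one
pair of the split count (its unique circuit and the rest), all in the level-`m` fibre of `B` — so
`(m − q)²·#levelF ≤ Σ_{pairs} #fibre_m` (`card_pairs_ge_sq`, `mul_card_levelF_le_sum_sq`), and the fibre weights of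
the giant-flat count become `1/(j + 1)²` in place of `1/(j + 1)` (`ncard_eRk_eq_ncard_le_le_giant_sq` in
S2SquareGiantCount). Axioms: standard.
-/

open scoped Matroid

namespace PercRepro

namespace S2

open Set Finset

variable {α : Type} {M : Matroid α}

/-- The spanning `(q+1)`-subsets of a finite set `B` of rank `q`, as a `Finset` of `Set`s: the `(q+1)`-subsets `D`
with `r(D) = q` and `B ⊆ cl(D)`. -/
noncomputable def spanF (M : Matroid α) [M.Finite] (q : ℕ) (B : Finset α) : Finset (Set α) := by
  classical
  exact ((B.powersetCard (q + 1)).filter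
    (fun D : Finset α => M.eRk (D : Set α) = (q : ℕ∞) ∧ (B : Set α) ⊆ M.closure (D : Set α))).image
      (fun D : Finset α => (D : Set α))

/-- Membership in `spanF`: `D ∈ spanF M q B` iff `D` is (the coercion of) a `(q+1)`-subset `D'` of `B` with
`r(D') = q` and `B ⊆ cl(D')`. -/
theorem mem_spanF [M.Finite] {q : ℕ} {B : Finset α} {D : Set α} :
    D ∈ spanF M q B ↔ ∃ D' : Finset α, D' ⊆ B ∧ D'.card = q + 1 ∧ M.eRk (D' : Set α) = (q : ℕ∞) ∧
      (B : Set α) ⊆ M.closure (D' : Set α) ∧ (D' : Set α) = D := by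
  classical
  unfold spanF
  rw [Finset.mem_image]
  constructor
  · rintro ⟨D', hD', rfl⟩
    rw [Finset.mem_filter, Finset.mem_powersetCard] at hD'
    exact ⟨D', hD'.1.1, hD'.1.2, hD'.2.1, hD'.2.2, rfl⟩
  · rintro ⟨D', h1, h2, h3, h4, rfl⟩
    exact ⟨D', by rw [Finset.mem_filter, Finset.mem_powersetCard]; exact ⟨⟨h1, h2⟩, h3, h4⟩, rfl⟩

open scoped Classical in
/-- **At least two elements of a basis lie on the fundamental circuit of an outside element** (every circuit has
`≥ 3` elements). -/
theorem two_le_card_filter_fundCircuit [M.Finite] (hcirc : ∀ C, M.IsCircuit C → 3 ≤ C.encard)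
    {I : Finset α} (hI : M.Indep (I : Set α)) {x : α} (hxcl : x ∈ M.closure (I : Set α)) (hxI : x ∉ I) :
    2 ≤ (I.filter (fun z => z ∈ M.fundCircuit x (I : Set α))).card := by
  classical
  have hC : M.IsCircuit (M.fundCircuit x (I : Set α)) :=
    hI.fundCircuit_isCircuit hxcl (by simpa using hxI)
  have hCsub : M.fundCircuit x (I : Set α) ⊆ insert x (I : Set α) := M.fundCircuit_subset_insert x _
  have hxC : x ∈ M.fundCircuit x (I : Set α) := M.mem_fundCircuit x _
  have hCfin : (M.fundCircuit x (I : Set α)).Finite := (I.finite_toSet.insert x).subset hCsub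
  have hC3 : 3 ≤ (M.fundCircuit x (I : Set α)).ncard := by
    have := hcirc _ hC
    rw [← hCfin.cast_ncard_eq] at this
    exact_mod_cast this
  -- `C ∖ {x} ⊆ I` has `≥ 2` elements
  have hsub : M.fundCircuit x (I : Set α) \ {x} ⊆
      ((I.filter (fun z => z ∈ M.fundCircuit x (I : Set α)) : Finset α) : Set α) := by
    intro z hz
    have hzC : z ∈ M.fundCircuit x (I : Set α) := hz.1
    have hzx : z ≠ x := by simpa using hz.2
    have hzI : z ∈ insert x (I : Set α) := hCsub hzC
    rcases hzI with h | h
    · exact absurd h hzx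
    · rw [Finset.mem_coe, Finset.mem_filter]
      exact ⟨by exact_mod_cast h, hzC⟩
  have h1 : (M.fundCircuit x (I : Set α) \ {x}).ncard + 1 = (M.fundCircuit x (I : Set α)).ncard :=
    Set.ncard_sdiff_singleton_add_one hxC hCfin
  have h2 := Set.ncard_le_ncard hsub (Finset.finite_toSet _)
  rw [Set.ncard_coe_finset] at h2
  omega

/-- A subset `D ⊆ B` whose closure contains `B` has the rank of `B`. -/
theorem eRk_eq_of_subset_of_subset_closure [M.Finite] {q : ℕ} {B D : Set α} (hDB : D ⊆ B)
    (hBq : M.eRk B = (q : ℕ∞)) (hcl : B ⊆ M.closure D) : M.eRk D = (q : ℕ∞) := by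
  have hle : M.eRk D ≤ q := by rw [← hBq]; exact M.eRk_mono hDB
  have hge : (q : ℕ∞) ≤ M.eRk D := by
    rw [← hBq, ← M.eRk_closure_eq D]; exact M.eRk_mono hcl
  exact le_antisymm hle hge

/-- **THE SQUARE**: a rank-`q` set `B` of `m = q + ν` elements (every circuit of `≥ 3` elements) has at least `ν²`
spanning `(q+1)`-subsets. -/
theorem card_spanF_ge_sq [M.Finite] (q : ℕ) (hq : 1 ≤ q) (hcirc : ∀ C, M.IsCircuit C → 3 ≤ C.encard)
    {B : Finset α} (hBE : (B : Set α) ⊆ M.E) (hBq : M.eRk (B : Set α) = (q : ℕ∞)) :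
    (B.card - q) ^ 2 ≤ (spanF M q B).card := by
  classical
  obtain ⟨I₀, hI₀⟩ := M.exists_isBasis (B : Set α) hBE
  have hI₀fin : I₀.Finite := B.finite_toSet.subset hI₀.subset
  set I : Finset α := hI₀fin.toFinset with hIdef
  have hIcoe : (I : Set α) = I₀ := Set.Finite.coe_toFinset _
  have hIB : I ⊆ B := by
    intro x hx
    rw [hIdef, Set.Finite.mem_toFinset] at hx
    exact_mod_cast hI₀.subset hx
  have hIcard : I.card = q := by
    have h := hI₀.encard_eq_eRk
    rw [hBq, ← hI₀fin.cast_ncard_eq] at h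
    have h' : I₀.ncard = q := by exact_mod_cast h
    rw [hIdef, ← Set.ncard_eq_toFinset_card _ hI₀fin]; exact h'
  have hIind : M.Indep (I : Set α) := by rw [hIcoe]; exact hI₀.indep
  have hBcl : (B : Set α) ⊆ M.closure (I : Set α) := by rw [hIcoe]; exact hI₀.subset_closure
  set X : Finset α := B \ I with hXdef
  have hXcard : X.card = B.card - q := by
    rw [hXdef, Finset.card_sdiff, Finset.inter_eq_left.2 hIB, hIcard]
  have hXI : ∀ x ∈ X, x ∉ I := fun x hx => (Finset.mem_sdiff.1 hx).2
  have hXB : ∀ x ∈ X, x ∈ B := fun x hx => (Finset.mem_sdiff.1 hx).1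
  have hXcl : ∀ x ∈ X, x ∈ M.closure (I : Set α) := fun x hx => hBcl (by exact_mod_cast hXB x hx)
  -- FAMILY 1: `I ∪ {x}`, `x ∈ X`
  set F₁ : Finset (Set α) := X.image (fun x => ((insert x I : Finset α) : Set α)) with hF₁
  have hF₁card : F₁.card = X.card := by
    rw [hF₁]
    apply Finset.card_image_of_injOn
    intro x hx y hy hxy
    have hxy'' : (insert x I : Finset α) = insert y I := by
      simp only at hxy
      exact Finset.coe_inj.1 hxy
    have hx' : x ∈ (insert y I : Finset α) := hxy'' ▸ Finset.mem_insert_self x I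
    rcases Finset.mem_insert.1 hx' with h | h
    · exact h
    · exact absurd h (hXI x hx)
  have hF₁sub : F₁ ⊆ spanF M q B := by
    intro D hD
    rw [hF₁, Finset.mem_image] at hD
    obtain ⟨x, hx, rfl⟩ := hD
    rw [mem_spanF]
    have hsubB : insert x I ⊆ B := Finset.insert_subset (hXB x hx) hIB
    have hcl : (B : Set α) ⊆ M.closure ((insert x I : Finset α) : Set α) := by
      refine hBcl.trans (M.closure_subset_closure ?_)
      rw [Finset.coe_insert]; exact Set.subset_insert x _
    refine ⟨insert x I, hsubB, ?_, ?_, hcl, rfl⟩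
    · rw [Finset.card_insert_of_notMem (hXI x hx), hIcard]
    · exact eRk_eq_of_subset_of_subset_closure (by exact_mod_cast hsubB) hBq hcl
  -- FAMILY 2: `(I ∖ {z}) ∪ P`, `P` a pair of `X`, `z ∈ I` on the fundamental circuit of an element of `P`
  set S : Finset (Σ _ : Finset α, α) :=
    (X.powersetCard 2).sigma (fun P => I.filter (fun z => ∃ x ∈ P, z ∈ M.fundCircuit x (I : Set α))) with hS
  set g : (Σ _ : Finset α, α) → Set α := fun s => ((s.1 ∪ I.erase s.2 : Finset α) : Set α) with hg
  set F₂ : Finset (Set α) := S.image g with hF₂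
  have hSdata : ∀ s ∈ S, s.1 ⊆ X ∧ s.1.card = 2 ∧ s.2 ∈ I ∧
      ∃ x ∈ s.1, s.2 ∈ M.fundCircuit x (I : Set α) := by
    intro s hs
    rw [hS, Finset.mem_sigma, Finset.mem_powersetCard, Finset.mem_filter] at hs
    exact ⟨hs.1.1, hs.1.2, hs.2.1, hs.2.2⟩
  -- `P ∪ I.erase z` determines `P = D ∖ I` and `z` = the element of `I` outside `D`
  have hsdiff : ∀ (P : Finset α) (z : α), P ⊆ X → (P ∪ I.erase z) \ I = P := by
    intro P z hPX
    ext a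
    simp only [Finset.mem_sdiff, Finset.mem_union, Finset.mem_erase]
    constructor
    · rintro ⟨h1 | h1, h2⟩
      · exact h1
      · exact absurd h1.2 h2
    · intro ha
      exact ⟨Or.inl ha, hXI a (hPX ha)⟩
  have hinter : ∀ (P : Finset α) (z : α), P ⊆ X → (P ∪ I.erase z) ∩ I = I.erase z := by
    intro P z hPX
    ext a
    simp only [Finset.mem_inter, Finset.mem_union, Finset.mem_erase]
    constructor
    · rintro ⟨h1 | h1, h2⟩
      · exact absurd h2 (hXI a (hPX h1))
      · exact h1
    · intro ha
      exact ⟨Or.inr ha, ha.2⟩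
  have hF₂card : F₂.card = S.card := by
    rw [hF₂]
    apply Finset.card_image_of_injOn
    intro s hs s' hs' h
    obtain ⟨hP, -, hz, -⟩ := hSdata s (by exact_mod_cast hs)
    obtain ⟨hP', -, hz', -⟩ := hSdata s' (by exact_mod_cast hs')
    have h' : (s.1 ∪ I.erase s.2 : Finset α) = s'.1 ∪ I.erase s'.2 := by
      have := h
      simp only [hg] at this
      exact_mod_cast this
    have hP1 : s.1 = s'.1 := by
      rw [← hsdiff s.1 s.2 hP, h', hsdiff s'.1 s'.2 hP']
    have hE : I.erase s.2 = I.erase s'.2 := by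
      rw [← hinter s.1 s.2 hP, h', hinter s'.1 s'.2 hP']
    have hz1 : s.2 = s'.2 := by
      by_contra hne
      have hmem : s.2 ∈ I.erase s'.2 := Finset.mem_erase.2 ⟨hne, hz⟩
      rw [← hE] at hmem
      exact Finset.notMem_erase s.2 I hmem
    exact Sigma.ext hP1 (heq_of_eq hz1)
  have hF₂sub : F₂ ⊆ spanF M q B := by
    intro D hD
    rw [hF₂, Finset.mem_image] at hD
    obtain ⟨s, hs, rfl⟩ := hD
    obtain ⟨hP, hP2, hz, x, hxP, hzC⟩ := hSdata s (by exact_mod_cast hs)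
    have hxX : x ∈ X := hP hxP
    have hxI : x ∉ I := hXI x hxX
    have hxcl : x ∈ M.closure (I : Set α) := hXcl x hxX
    -- `z ∈ cl((I ∪ {x}) ∖ {z})`, so the closure of `(I ∪ {x}) ∖ {z}` is that of `I ∪ {x}`
    have hC : M.IsCircuit (M.fundCircuit x (I : Set α)) :=
      hIind.fundCircuit_isCircuit hxcl (by simpa using hxI)
    have hCsub : M.fundCircuit x (I : Set α) ⊆ insert x (I : Set α) := M.fundCircuit_subset_insert x _
    have hzcl : s.2 ∈ M.closure ((insert x (I : Set α)) \ {s.2}) :=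
      M.closure_subset_closure (Set.sdiff_subset_sdiff_left hCsub) (hC.mem_closure_sdiff_singleton_of_mem hzC)
    have hcleq : M.closure ((insert x (I : Set α)) \ {s.2}) = M.closure (insert x (I : Set α)) :=
      M.closure_sdiff_singleton_eq_closure hzcl
    have hsubD : (insert x (I : Set α)) \ {s.2} ⊆ ((s.1 ∪ I.erase s.2 : Finset α) : Set α) := by
      intro a ha
      rw [Finset.coe_union, Finset.coe_erase]
      rcases ha.1 with h | h
      · exact Or.inl (by rw [h]; exact_mod_cast hxP)
      · exact Or.inr ⟨h, ha.2⟩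
    have hcl : (B : Set α) ⊆ M.closure ((s.1 ∪ I.erase s.2 : Finset α) : Set α) := by
      calc (B : Set α) ⊆ M.closure (I : Set α) := hBcl
        _ ⊆ M.closure (insert x (I : Set α)) := M.closure_subset_closure (Set.subset_insert x _)
        _ = M.closure ((insert x (I : Set α)) \ {s.2}) := hcleq.symm
        _ ⊆ M.closure ((s.1 ∪ I.erase s.2 : Finset α) : Set α) := M.closure_subset_closure hsubD
    have hsubB : s.1 ∪ I.erase s.2 ⊆ B :=
      Finset.union_subset (hP.trans (Finset.sdiff_subset)) ((Finset.erase_subset _ _).trans hIB)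
    rw [mem_spanF]
    refine ⟨s.1 ∪ I.erase s.2, hsubB, ?_, ?_, hcl, rfl⟩
    · have hdisj : Disjoint s.1 (I.erase s.2) := by
        rw [Finset.disjoint_left]
        intro a ha ha'
        exact hXI a (hP ha) (Finset.mem_erase.1 ha').2
      rw [Finset.card_union_of_disjoint hdisj, hP2, Finset.card_erase_of_mem hz, hIcard]
      omega
    · exact eRk_eq_of_subset_of_subset_closure (by exact_mod_cast hsubB) hBq hcl
  -- the two families are disjoint: family 1 contains `I`, family 2 misses `z ∈ I`
  have hdisj : Disjoint F₁ F₂ := by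
    rw [Finset.disjoint_left]
    intro D hD1 hD2
    rw [hF₁, Finset.mem_image] at hD1
    rw [hF₂, Finset.mem_image] at hD2
    obtain ⟨x, hx, rfl⟩ := hD1
    obtain ⟨s, hs, hsD⟩ := hD2
    obtain ⟨hP, -, hz, -⟩ := hSdata s (by exact_mod_cast hs)
    have h' : (s.1 ∪ I.erase s.2 : Finset α) = insert x I := by
      have := hsD
      simp only [hg] at this
      exact_mod_cast this
    have hzmem : s.2 ∈ s.1 ∪ I.erase s.2 := by
      rw [h']; exact Finset.mem_insert_of_mem hz
    rcases Finset.mem_union.1 hzmem with h | h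
    · exact hXI _ (hP h) hz
    · exact Finset.notMem_erase s.2 I h
  -- counting: `#S ≥ 2·C(ν, 2)`
  have hScard : 2 * (X.powersetCard 2).card ≤ S.card := by
    rw [hS, Finset.card_sigma]
    have : ∀ P ∈ X.powersetCard 2,
        2 ≤ (I.filter (fun z => ∃ x ∈ P, z ∈ M.fundCircuit x (I : Set α))).card := by
      intro P hP
      rw [Finset.mem_powersetCard] at hP
      obtain ⟨x, hxP⟩ : P.Nonempty := Finset.card_pos.1 (by omega)
      have hxX : x ∈ X := hP.1 hxP
      have h2 := two_le_card_filter_fundCircuit hcirc hIind (hXcl x hxX) (hXI x hxX)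
      refine h2.trans (Finset.card_le_card ?_)
      intro z hz
      rw [Finset.mem_filter] at hz ⊢
      exact ⟨hz.1, x, hxP, hz.2⟩
    calc 2 * (X.powersetCard 2).card = ∑ _P ∈ X.powersetCard 2, 2 := by
          simp [mul_comm]
      _ ≤ _ := Finset.sum_le_sum this
  have hpow : (X.powersetCard 2).card = X.card.choose 2 := Finset.card_powersetCard 2 X
  have hchoose : 2 * X.card.choose 2 = X.card * (X.card - 1) := by
    rw [Nat.choose_two_right]
    exact Nat.two_mul_div_two_of_even (Nat.even_mul_pred_self X.card)
  -- assemble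
  have hunion : (F₁ ∪ F₂).card ≤ (spanF M q B).card :=
    Finset.card_le_card (Finset.union_subset hF₁sub hF₂sub)
  rw [Finset.card_union_of_disjoint hdisj, hF₁card, hF₂card] at hunion
  rw [← hXcard]
  have hsq : X.card ^ 2 = X.card + X.card * (X.card - 1) := by
    cases h : X.card with
    | zero => rfl
    | succ k => rw [Nat.succ_sub_one]; ring
  rw [hsq]
  omega

open scoped Classical in
/-- **The square multiplicity of the pairs**: a rank-`q` set `B` of `m > q` elements lies in the level-`m` fibre of at
least `(m − q)²` pairs — every spanning `(q+1)`-subset `D` of `B` is the union `C ∪ B′` of exactly one pair (its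
circuit, by night-1's `exists_circuit_extension_exact`), and `B` lies in that pair's fibre. -/
theorem card_pairs_ge_sq [M.Finite] (q : ℕ) (hq : 1 ≤ q) (hcirc : ∀ C, M.IsCircuit C → 3 ≤ C.encard)
    {B : Finset α} (hBE : (B : Set α) ⊆ M.E) (hBq : M.eRk (B : Set α) = (q : ℕ∞)) :
    (B.card - q) ^ 2 ≤ ((Matroid.pairsF M q).filter (fun p => p.1 ∪ p.2 ⊆ (B : Set α) ∧
      (B : Set α) ⊆ M.closure (p.1 ∪ p.2))).card := by
  classical
  refine (card_spanF_ge_sq q hq hcirc hBE hBq).trans ?_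
  apply Finset.card_le_card_of_surjOn (fun p : Set α × Set α => p.1 ∪ p.2)
  intro D hD
  rw [Finset.mem_coe, mem_spanF] at hD
  obtain ⟨D', hD'B, hD'card, hD'q, hBcl, rfl⟩ := hD
  have hD'E : (D' : Set α) ⊆ M.E := (Finset.coe_subset.2 hD'B).trans hBE
  have hD'ncard : (D' : Set α).ncard = q + 1 := by rw [Set.ncard_coe_finset]; exact hD'card
  obtain ⟨C, B', hC, hCD, hB'D, hdisj, hcard, hDcl⟩ :=
    Matroid.exists_circuit_extension_exact hD'E hD'q (by rw [hD'ncard]; omega)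
  have hCfin : C.Finite := D'.finite_toSet.subset hCD
  have hB'fin : B'.Finite := D'.finite_toSet.subset hB'D
  have hunion_sub : C ∪ B' ⊆ (D' : Set α) := Set.union_subset hCD hB'D
  have hunion_card : (C ∪ B').ncard = q + 1 := by
    rw [Set.ncard_union_eq hdisj.symm hCfin hB'fin]; exact hcard
  have hunion : C ∪ B' = (D' : Set α) :=
    Set.eq_of_subset_of_ncard_le hunion_sub (by rw [hunion_card, hD'ncard]) D'.finite_toSet
  have hC3 : 3 ≤ C.ncard := by
    have := hcirc C hC
    rw [← hCfin.cast_ncard_eq] at this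
    exact_mod_cast this
  have hCle : C.ncard ≤ q + 1 := by omega
  refine ⟨(C, B'), ?_, ?_⟩
  · rw [Finset.mem_coe, Finset.mem_filter]
    refine ⟨?_, ?_, ?_⟩
    · unfold Matroid.pairsF
      rw [Finset.mem_filter]
      refine ⟨?_, hdisj, by show M.eRk (C ∪ B') ≤ q; rw [hunion]; exact hD'q.le⟩
      rw [Finset.mem_biUnion]
      refine ⟨C.ncard, by rw [Finset.mem_Icc]; omega, ?_⟩
      rw [Finset.mem_product]
      refine ⟨Matroid.mem_circF.2 ⟨hC, rfl⟩, ?_⟩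
      apply Matroid.mem_subsF_of
      · rw [Matroid.coe_groundF]; exact hB'D.trans hD'E
      · show B'.ncard = q + 1 - C.ncard
        omega
    · show C ∪ B' ⊆ (B : Set α)
      rw [hunion]; exact_mod_cast hD'B
    · show (B : Set α) ⊆ M.closure (C ∪ B')
      rw [hunion]; exact hBcl
  · exact hunion

open scoped Classical in
/-- **The level-`m` double count with the square multiplicity**:
`(m − q)²·#levelF M q m ≤ Σ_{p ∈ pairsF M q} #fibreLevel M q p m`. -/
theorem mul_card_levelF_le_sum_sq [M.Finite] (q : ℕ) (hq : 1 ≤ q)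
    (hcirc : ∀ C, M.IsCircuit C → 3 ≤ C.encard) (m : ℕ) :
    (m - q) ^ 2 * (Matroid.levelF M q m).card ≤
      ∑ p ∈ Matroid.pairsF M q, (Matroid.fibreLevel M q p m).card := by
  have hcomm : ∑ p ∈ Matroid.pairsF M q, (Matroid.fibreLevel M q p m).card =
      ∑ B ∈ Matroid.levelF M q m, ((Matroid.pairsF M q).filter (fun p => p.1 ∪ p.2 ⊆ (B : Set α) ∧
        (B : Set α) ⊆ M.closure (p.1 ∪ p.2))).card := by
    unfold Matroid.fibreLevel
    simp only [Finset.card_filter]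
    exact Finset.sum_comm
  rw [hcomm]
  calc (m - q) ^ 2 * (Matroid.levelF M q m).card = ∑ _B ∈ Matroid.levelF M q m, (m - q) ^ 2 := by
        simp [mul_comm]
    _ ≤ _ := by
      apply Finset.sum_le_sum
      intro B hB
      obtain ⟨hBg, hBm, hBq⟩ := Matroid.mem_levelF.1 hB
      have hBE : (B : Set α) ⊆ M.E := by rw [← Matroid.coe_groundF]; exact_mod_cast hBg
      have := card_pairs_ge_sq q hq hcirc hBE hBq
      rw [hBm] at this
      exact this

open scoped Classical in
/-- **The level-`m` count with the giant split and the square multiplicity.** -/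
theorem mul_card_levelF_le_giant_sq [M.Finite] (q f f' ν₁ : ℕ) (hq : 1 ≤ q)
    (hcirc : ∀ C, M.IsCircuit C → 3 ≤ C.encard)
    (hflat : ∀ X ⊆ M.E, M.eRk X ≤ q → X.ncard ≤ f) {d : ℕ} (hd : M.E.encard = M.eRank + d) (m : ℕ) :
    (m - q) ^ 2 * (Matroid.levelF M q m).card ≤
      (Matroid.pairsSmall M q f').card * (f' - q).choose (m - (q + 1)) +
        (Matroid.pairsMid M q f' ν₁).card * (min (f - (q + 1)) (ν₁ - 2)).choose (m - (q + 1)) +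
        (Matroid.pairsGiant M q f' ν₁).card * (min f (q + d) - (q + 1)).choose (m - (q + 1)) := by
  have hsplit : ∑ p ∈ Matroid.pairsF M q, (Matroid.fibreLevel M q p m).card =
      ∑ p ∈ Matroid.pairsSmall M q f', (Matroid.fibreLevel M q p m).card +
        ∑ p ∈ Matroid.pairsBig M q f', (Matroid.fibreLevel M q p m).card := by
    unfold Matroid.pairsSmall Matroid.pairsBig
    exact (Finset.sum_filter_add_sum_filter_not (Matroid.pairsF M q) _ _).symm
  have hsplit2 : ∑ p ∈ Matroid.pairsBig M q f', (Matroid.fibreLevel M q p m).card =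
      ∑ p ∈ Matroid.pairsGiant M q f' ν₁, (Matroid.fibreLevel M q p m).card +
        ∑ p ∈ Matroid.pairsMid M q f' ν₁, (Matroid.fibreLevel M q p m).card := by
    unfold Matroid.pairsGiant Matroid.pairsMid
    exact (Finset.sum_filter_add_sum_filter_not (Matroid.pairsBig M q f') _ _).symm
  calc (m - q) ^ 2 * (Matroid.levelF M q m).card
      ≤ ∑ p ∈ Matroid.pairsF M q, (Matroid.fibreLevel M q p m).card :=
        mul_card_levelF_le_sum_sq q hq hcirc m
    _ = ∑ p ∈ Matroid.pairsSmall M q f', (Matroid.fibreLevel M q p m).card +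
          (∑ p ∈ Matroid.pairsGiant M q f' ν₁, (Matroid.fibreLevel M q p m).card +
            ∑ p ∈ Matroid.pairsMid M q f' ν₁, (Matroid.fibreLevel M q p m).card) := by rw [hsplit, hsplit2]
    _ ≤ ∑ _p ∈ Matroid.pairsSmall M q f', (f' - q).choose (m - (q + 1)) +
          (∑ _p ∈ Matroid.pairsGiant M q f' ν₁, (min f (q + d) - (q + 1)).choose (m - (q + 1)) +
            ∑ _p ∈ Matroid.pairsMid M q f' ν₁, (min (f - (q + 1)) (ν₁ - 2)).choose (m - (q + 1))) := by
        gcongr with p hp p hp p hp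
        · exact Matroid.card_fibreLevel_small q f' hp m
        · exact Matroid.card_fibreLevel_giant q f f' ν₁ hflat hd hp m
        · exact Matroid.card_fibreLevel_mid q f f' ν₁ hflat hp m
    _ = _ := by
        simp only [Finset.sum_const, smul_eq_mul]
        ring

end S2

end PercRepro
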